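import Literature.NumberTheory.EllipticCurves.ComplexMultiplicationLocalFactorsAux
import Literature.NumberTheory.EllipticCurves.TwoIsogenyPointCount
import Literature.NumberTheory.EllipticCurves.LocalReductionKrausTwo
import Literature.NumberTheory.EllipticCurves.IsogenyCompProofs
import HarnessLib

/-!
# Equal `L`-functions across the CM isogeny class `j = 16581375 ~ j = -3375` and all its twists

Sibling file of `Literature.NumberTheory.EllipticCurves.ComplexMultiplication` (D-0014 append
protocol; everything here is proved). The curve `E : y² = x³ - 42x² - 7x` (`j = 16581375 = 255³`,
CM by `ℤ[√-7]`, the order of conductor `2` in `ℚ(√-7)`) is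
`2`-isogenous over `ℚ` to `y² = x³ + 21x² + 112x` (`j = -3375`, CM by `ℤ[(1+√-7)/2]`)
(Silverman, *AEC*, III.4.5; the tree's `isIsogenous_cm28`), and so are all quadratic twists.
As in `ComplexMultiplicationLocalFactors16/12` we prove the corresponding instance of Knapp's
Theorem 11.67 (*Elliptic Curves*, p. 281; the named fact `Literature.NumberTheory.EllipticCurves.LFunction_eq_of_isIsogenous`)
prime by prime for Mathlib's `WeierstrassCurve.LFunction`:

`L(E_d, s) = L(E'_d, s)` for `E_d = [0, -42d, 0, -7d², 0]`, `E'_d = [0, 21d, 0, 112d², 0]`, every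
squarefree integer `d` (`WeierstrassCurve.LFunction_cm28_eq`). Invariants:
`Δ(E_d) = 2¹²7³d⁶`, `c₄(E_d) = 2⁴·1785d²`, `c₆(E_d) = 2⁶·75411d³`; `Δ(E'_d) = -2¹²7³d⁶`,
`c₄(E'_d) = 2⁴·105d²`, `c₆(E'_d) = 2⁶·1323d³`.

* odd `p ∤ 7d`: good reduction of both models, `#E_d(𝔽_p) = #E'_d(𝔽_p)` by the explicit
  `2`-isogeny over `𝔽_p` and the prime-degree torsor lemma (`natCard_point_twoTorsionNF_eq`);
* `p = 7` and odd `p ∣ d`: additive reduction of both (`ord_p(Δ) ∈ {3, 6, 9}`, `ord_p(j) ≥ 0`);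
* `p = 2`, `d` even: additive reduction of both (`ord₂(Δ) = 18 ∉ 12ℤ`, `ord₂(j) ≥ 0`);
* `p = 2`, `d ≡ 3 (mod 4)`: `ord₂(Δ) = ord₂(Δ_min) = 12`; both have additive reduction because
  neither has good reduction, by **Kraus's necessary condition**
  (`not_hasGoodReductionAt_two_of_c₆_eq_64_mul`: `c₆ = 64N`, `N = 75411d³ ≡ 1323d³ ≡ 1 (mod 4)`);
* `p = 2`, `d ≡ 1 (mod 4)`: **both have good reduction at `2`**, with the explicit `2`-integral
  models `⟨2, 14d - 1, 1, t⟩ • E_d = [1, -1, t/4, (3 - 2t - 595d²)/16, (-5586d³ + 595d² - 1 - t²)/64]`,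
  `⟨2, -7d - 1, 1, t⟩ • E'_d = [1, -1, t/4, (3 - 2t - 35d²)/16, (-98d³ + 35d² - 1 - t²)/64]`
  (`t = 0` for `d ≡ 1 (mod 8)`, `t = 4` for `d ≡ 5 (mod 8)`), of odd discriminants `±7³d⁶`, whose
  reductions mod `2` are `y² + xy = x³ + x² + αx + (α + 1)` (two points) resp.
  `y² + xy + y = x³ + x² + αx` (four points) on both sides: `a₂(E_d) = a₂(E'_d) = ±1`, the
  Frobenius being ordinary as `2` splits in `ℚ(√-7)`.

## References

* A. W. Knapp, *Elliptic Curves* (1992), Thm. 11.67 and its proof (PDF pp. 281–282). [cite: Knapp1993]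
* J. H. Silverman, *AEC* 2nd ed. (2009), III.4.5, VII.1, VII.5.1, §C.16, Ex. 5.4(a). [cite: SilvermanAEC2009]
* A. Kraus, Acta Arith. 54 (1989), Prop. 2; Cremona, *Algorithms*, §3.2. [cite: Kraus1989]
* J. H. Silverman, *Advanced Topics* (1994), App. A §3 (`D = -7`, `f = 1, 2`). [cite: SilvermanAdvancedTopics1994, App. A §3]
-/

noncomputable section

open scoped Classical

open IsDedekindDomain NumberField Rat.HeightOneSpectrum Polynomial

namespace WeierstrassCurve

/-! ## The models -/

/-- The twist family of `y² = x³ - 42x² - 7x` (`j = 16581375 = 255³`): `E_d = [0, -42d, 0, -7d², 0]`.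
Silverman, *Advanced Topics*, App. A §3 (`D = -7`, `f = 2`). [folklore] -/
def cm28Model (d : ℤ) : WeierstrassCurve ℤ :=
  ⟨0, -42 * d, 0, -7 * d ^ 2, 0⟩

/-- The twist family of `y² = x³ + 21x² + 112x` (`j = -3375`, CM by `ℤ[(1+√-7)/2]`), the
`2`-isogenous partner of `cm28Model d` (the `2`-isogeny codomain `[0, 84d, 0, 1792d², 0]`
rescaled by `u = 2`): `E'_d = [0, 21d, 0, 112d², 0]`. [folklore] -/
def cm28Codomain (d : ℤ) : WeierstrassCurve ℤ :=
  ⟨0, 21 * d, 0, 112 * d ^ 2, 0⟩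

section Invariants

variable (d : ℤ)

/-- `E_d` base-changed along `ℤ → R`. [folklore] -/
@[simp] theorem map_cm28Model {R : Type*} [CommRing R] (f : ℤ →+* R) :
    (cm28Model d).map f = ⟨0, -42 * (d : R), 0, -7 * (d : R) ^ 2, 0⟩ := by
  simp [cm28Model, WeierstrassCurve.map]

/-- `E'_d` base-changed along `ℤ → R`. [folklore] -/
@[simp] theorem map_cm28Codomain {R : Type*} [CommRing R] (f : ℤ →+* R) :
    (cm28Codomain d).map f = ⟨0, 21 * (d : R), 0, 112 * (d : R) ^ 2, 0⟩ := by
  simp [cm28Codomain, WeierstrassCurve.map]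

/-- `Δ(E_d) = 2¹²7³ d⁶`. [folklore] -/
theorem cm28Model_Δ : (cm28Model d).Δ = 2 ^ 12 * 7 ^ 3 * d ^ 6 := by
  simp only [cm28Model, Δ, b₂, b₄, b₆, b₈]; ring

/-- `c₄(E_d) = 2⁴·1785 d²`. [folklore] -/
theorem cm28Model_c₄ : (cm28Model d).c₄ = 2 ^ 4 * 1785 * d ^ 2 := by
  simp only [cm28Model, c₄, b₂, b₄]; ring

/-- `c₆(E_d) = 2⁶·75411 d³`. [folklore] -/
theorem cm28Model_c₆ : (cm28Model d).c₆ = 2 ^ 6 * 75411 * d ^ 3 := by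
  simp only [cm28Model, c₆, b₂, b₄, b₆]; ring

/-- `Δ(E'_d) = -2¹²7³ d⁶`. [folklore] -/
theorem cm28Codomain_Δ : (cm28Codomain d).Δ = -(2 ^ 12 * 7 ^ 3 * d ^ 6) := by
  simp only [cm28Codomain, Δ, b₂, b₄, b₆, b₈]; ring

/-- `c₄(E'_d) = 2⁴·105 d²`. [folklore] -/
theorem cm28Codomain_c₄ : (cm28Codomain d).c₄ = 2 ^ 4 * 105 * d ^ 2 := by
  simp only [cm28Codomain, c₄, b₂, b₄]; ring

/-- `c₆(E'_d) = 2⁶·1323 d³`. [folklore] -/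
theorem cm28Codomain_c₆ : (cm28Codomain d).c₆ = 2 ^ 6 * 1323 * d ^ 3 := by
  simp only [cm28Codomain, c₆, b₂, b₄, b₆]; ring

end Invariants

/-! ## Additive places: `p = 7`, odd `p ∣ d`, `p = 2` with `d` even -/

section Additive

variable (v : HeightOneSpectrum (𝓞 ℚ)) {d : ℤ}

/-- For odd `p ∣ 7d` or `p = 2 ∣ d` (`d` squarefree), **`E_d` has additive reduction at `p`**:
`ord_p(Δ) ∈ {3, 6, 9, 18} ∌ 12ℤ` and `3 ord_p(c₄) ≥ ord_p(Δ)`.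
[cite: SilvermanAEC2009, VII.5 Prop. 5.1(c)] -/
theorem hasAdditiveReductionAt_cm28Model (hsq : Squarefree d)
    (hv : (natGenerator v : ℤ) ∣ 7 * d ∨ (natGenerator v = 2 ∧ (2 : ℤ) ∣ d)) :
    ((cm28Model d).map (Int.castRingHom ℚ)).HasAdditiveReductionAt v := by
  have hpZ := Rat.prime_natGenerator_int v
  by_cases hpd : (natGenerator v : ℤ) ∣ d
  · obtain ⟨d₀, rfl, hd₀⟩ := Int.exists_eq_mul_not_dvd_of_squarefree hpZ hsq hpd
    have hd6 : ¬ ((natGenerator v : ℕ) : ℤ) ∣ d₀ ^ 6 := fun h ↦ hd₀ (hpZ.dvd_of_dvd_pow h)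
    by_cases hp2 : natGenerator v = 2
    · -- `2 ∣ d`: `Δ = 2¹⁸ (343 d₀⁶)`, `c₄ = 2⁶ (1785 d₀²)`
      have hm : ¬ ((natGenerator v : ℕ) : ℤ) ∣ 343 * d₀ ^ 6 := fun h ↦ by
        rcases hpZ.dvd_or_dvd h with h | h
        · rw [hp2] at h; norm_num at h
        · exact hd6 h
      refine hasAdditiveReductionAt_map_of_data v _ (n := 18) (e := 6) (m := 343 * d₀ ^ 6)
        (k := 1785 * d₀ ^ 2) ?_ hm (by decide) ?_ (by norm_num)
      · rw [cm28Model_Δ, hp2]; push_cast; ring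
      · rw [cm28Model_c₄, hp2]; push_cast; ring
    by_cases hp7 : natGenerator v = 7
    · -- `7 ∣ d`: `Δ = 7⁹ (2¹² d₀⁶)`, `c₄ = 7³ (4080 d₀²)`
      have hm : ¬ ((natGenerator v : ℕ) : ℤ) ∣ 2 ^ 12 * d₀ ^ 6 := fun h ↦ by
        rcases hpZ.dvd_or_dvd h with h | h
        · rw [hp7] at h; norm_num at h
        · exact hd6 h
      refine hasAdditiveReductionAt_map_of_data v _ (n := 9) (e := 3) (m := 2 ^ 12 * d₀ ^ 6)
        (k := 4080 * d₀ ^ 2) ?_ hm (by decide) ?_ (by norm_num)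
      · rw [cm28Model_Δ, hp7]; push_cast; ring
      · rw [cm28Model_c₄, hp7]; push_cast; ring
    · -- other `p ∣ d`: `Δ = p⁶ (2¹²7³ d₀⁶)`, `c₄ = p² (28560 d₀²)`
      have hm : ¬ ((natGenerator v : ℕ) : ℤ) ∣ 2 ^ 12 * 7 ^ 3 * d₀ ^ 6 := fun h ↦ by
        rcases hpZ.dvd_or_dvd h with h | h
        · rcases hpZ.dvd_or_dvd h with h | h
          · exact Rat.not_natGenerator_dvd_of_ne v Nat.prime_two hp2 (hpZ.dvd_of_dvd_pow h)
          · exact Rat.not_natGenerator_dvd_of_ne v (by norm_num) hp7 (hpZ.dvd_of_dvd_pow h)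
        · exact hd6 h
      refine hasAdditiveReductionAt_map_of_data v _ (n := 6) (e := 2) (m := 2 ^ 12 * 7 ^ 3 * d₀ ^ 6)
        (k := 28560 * d₀ ^ 2) ?_ hm (by decide) ?_ (by norm_num)
      · rw [cm28Model_Δ]; ring
      · rw [cm28Model_c₄]; ring
  · -- `p ∤ d`: then `p = 7`
    have hd6 : ¬ ((natGenerator v : ℕ) : ℤ) ∣ d ^ 6 := fun h ↦ hpd (hpZ.dvd_of_dvd_pow h)
    have hp7 : natGenerator v = 7 := by
      rcases hv with h | ⟨hp2', h⟩
      · rcases hpZ.dvd_or_dvd h with h | h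
        · exact Rat.natGenerator_eq_of_dvd v (by norm_num) h
        · exact absurd h hpd
      · rw [hp2'] at hpd; push_cast at hpd; exact absurd h hpd
    have hm : ¬ ((natGenerator v : ℕ) : ℤ) ∣ 2 ^ 12 * d ^ 6 := fun h ↦ by
      rcases hpZ.dvd_or_dvd h with h | h
      · rw [hp7] at h; norm_num at h
      · exact hd6 h
    refine hasAdditiveReductionAt_map_of_data v _ (n := 3) (e := 1) (m := 2 ^ 12 * d ^ 6)
      (k := 4080 * d ^ 2) ?_ hm (by decide) ?_ (by norm_num)
    · rw [cm28Model_Δ, hp7]; push_cast; ring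
    · rw [cm28Model_c₄, hp7]; push_cast; ring

/-- For odd `p ∣ 7d` or `p = 2 ∣ d` (`d` squarefree), **`E'_d` has additive reduction at `p`**:
`ord_p(Δ) ∈ {3, 6, 9, 18}`, `3 ord_p(c₄) ≥ ord_p(Δ)` (`c₄ = 2⁴·105 d²`).
[cite: SilvermanAEC2009, VII.5 Prop. 5.1(c)] -/
theorem hasAdditiveReductionAt_cm28Codomain (hsq : Squarefree d)
    (hv : (natGenerator v : ℤ) ∣ 7 * d ∨ (natGenerator v = 2 ∧ (2 : ℤ) ∣ d)) :
    ((cm28Codomain d).map (Int.castRingHom ℚ)).HasAdditiveReductionAt v := by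
  have hpZ := Rat.prime_natGenerator_int v
  by_cases hpd : (natGenerator v : ℤ) ∣ d
  · obtain ⟨d₀, rfl, hd₀⟩ := Int.exists_eq_mul_not_dvd_of_squarefree hpZ hsq hpd
    have hd6 : ¬ ((natGenerator v : ℕ) : ℤ) ∣ d₀ ^ 6 := fun h ↦ hd₀ (hpZ.dvd_of_dvd_pow h)
    by_cases hp2 : natGenerator v = 2
    · have hm : ¬ ((natGenerator v : ℕ) : ℤ) ∣ -(343 * d₀ ^ 6) := fun h ↦ by
        rw [dvd_neg] at h
        rcases hpZ.dvd_or_dvd h with h | h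
        · rw [hp2] at h; norm_num at h
        · exact hd6 h
      refine hasAdditiveReductionAt_map_of_data v _ (n := 18) (e := 6) (m := -(343 * d₀ ^ 6))
        (k := 105 * d₀ ^ 2) ?_ hm (by decide) ?_ (by norm_num)
      · rw [cm28Codomain_Δ, hp2]; push_cast; ring
      · rw [cm28Codomain_c₄, hp2]; push_cast; ring
    by_cases hp7 : natGenerator v = 7
    · have hm : ¬ ((natGenerator v : ℕ) : ℤ) ∣ -(2 ^ 12 * d₀ ^ 6) := fun h ↦ by
        rw [dvd_neg] at h
        rcases hpZ.dvd_or_dvd h with h | h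
        · rw [hp7] at h; norm_num at h
        · exact hd6 h
      refine hasAdditiveReductionAt_map_of_data v _ (n := 9) (e := 3) (m := -(2 ^ 12 * d₀ ^ 6))
        (k := 240 * d₀ ^ 2) ?_ hm (by decide) ?_ (by norm_num)
      · rw [cm28Codomain_Δ, hp7]; push_cast; ring
      · rw [cm28Codomain_c₄, hp7]; push_cast; ring
    · have hm : ¬ ((natGenerator v : ℕ) : ℤ) ∣ -(2 ^ 12 * 7 ^ 3 * d₀ ^ 6) := fun h ↦ by
        rw [dvd_neg] at h
        rcases hpZ.dvd_or_dvd h with h | h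
        · rcases hpZ.dvd_or_dvd h with h | h
          · exact Rat.not_natGenerator_dvd_of_ne v Nat.prime_two hp2 (hpZ.dvd_of_dvd_pow h)
          · exact Rat.not_natGenerator_dvd_of_ne v (by norm_num) hp7 (hpZ.dvd_of_dvd_pow h)
        · exact hd6 h
      refine hasAdditiveReductionAt_map_of_data v _ (n := 6) (e := 2)
        (m := -(2 ^ 12 * 7 ^ 3 * d₀ ^ 6)) (k := 1680 * d₀ ^ 2) ?_ hm (by decide) ?_ (by norm_num)
      · rw [cm28Codomain_Δ]; ring
      · rw [cm28Codomain_c₄]; ring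
  · have hd6 : ¬ ((natGenerator v : ℕ) : ℤ) ∣ d ^ 6 := fun h ↦ hpd (hpZ.dvd_of_dvd_pow h)
    have hp7 : natGenerator v = 7 := by
      rcases hv with h | ⟨hp2', h⟩
      · rcases hpZ.dvd_or_dvd h with h | h
        · exact Rat.natGenerator_eq_of_dvd v (by norm_num) h
        · exact absurd h hpd
      · rw [hp2'] at hpd; push_cast at hpd; exact absurd h hpd
    have hm : ¬ ((natGenerator v : ℕ) : ℤ) ∣ -(2 ^ 12 * d ^ 6) := fun h ↦ by
      rw [dvd_neg] at h
      rcases hpZ.dvd_or_dvd h with h | h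
      · rw [hp7] at h; norm_num at h
      · exact hd6 h
    refine hasAdditiveReductionAt_map_of_data v _ (n := 3) (e := 1) (m := -(2 ^ 12 * d ^ 6))
      (k := 240 * d ^ 2) ?_ hm (by decide) ?_ (by norm_num)
    · rw [cm28Codomain_Δ, hp7]; push_cast; ring
    · rw [cm28Codomain_c₄, hp7]; push_cast; ring

end Additive

/-! ## `p = 2`, `d ≡ 3 (mod 4)`: additive reduction by Kraus's condition -/

section TwoThreeModFour

variable (v : HeightOneSpectrum (𝓞 ℚ)) {d : ℤ}

/-- `d ≡ 3 (mod 4)` as `d = 4k + 3`: then `75411 d³ ≡ 1 (mod 4)` and `1323 d³ ≡ 1 (mod 4)`.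
[folklore] -/
theorem cm28_kraus_data {k : ℤ} (hd : d = 4 * k + 3) :
    (4 : ℤ) ∣ 75411 * d ^ 3 - 1 ∧ (4 : ℤ) ∣ 1323 * d ^ 3 - 1 := by
  subst hd
  exact ⟨⟨1206576 * k ^ 3 + 2714796 * k ^ 2 + 2036097 * k + 509024, by ring⟩,
    ⟨21168 * k ^ 3 + 47628 * k ^ 2 + 35721 * k + 8930, by ring⟩⟩

/-- **For `d ≡ 3 (mod 4)` squarefree, `E_d` and `E'_d` have additive reduction at `2`.** Here
`ord₂(Δ) = 12` and Remark VII.1.1 is silent; but neither curve has good reduction at `2` by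
Kraus's necessary condition (`c₆ = 64N` with `N = 75411d³, 1323d³ ≡ 1 (mod 4)`,
`not_hasGoodReductionAt_two_of_c₆_eq_64_mul`), and `ord₂(j) ≥ 0` excludes multiplicative
reduction (`hasAdditiveReductionAt_of_not_hasGoodReductionAt_of_cube_le`).
[cite: Kraus1989, Prop. 2] [cite: SilvermanAEC2009, VII.5 Prop. 5.1] -/
theorem hasAdditiveReductionAt_cm28_two_of_three_mod_four (hv : natGenerator v = 2) {k : ℤ}
    (hd : d = 4 * k + 3) :
    ((cm28Model d).map (Int.castRingHom ℚ)).HasAdditiveReductionAt v ∧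
      ((cm28Codomain d).map (Int.castRingHom ℚ)).HasAdditiveReductionAt v := by
  obtain ⟨hN, hN'⟩ := cm28_kraus_data hd
  have hdodd : ¬ (2 : ℤ) ∣ d := by
    rw [hd]; intro ⟨m, hm⟩; omega
  have hd6 : ¬ ((natGenerator v : ℕ) : ℤ) ∣ d ^ 6 := fun h ↦ by
    rw [hv] at h; push_cast at h
    exact hdodd (Int.prime_two.dvd_of_dvd_pow h)
  have hm : ¬ ((natGenerator v : ℕ) : ℤ) ∣ 343 * d ^ 6 := fun h ↦ by
    rcases (Rat.prime_natGenerator_int v).dvd_or_dvd h with h | h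
    · rw [hv] at h; norm_num at h
    · exact hd6 h
  have hm' : ¬ ((natGenerator v : ℕ) : ℤ) ∣ -(343 * d ^ 6) := by rwa [dvd_neg]
  have hvΔ : v.valuation ℚ ((cm28Model d).map (Int.castRingHom ℚ)).Δ = WithZero.exp (-12 : ℤ) := by
    rw [map_Δ, eq_intCast, cm28Model_Δ, show (2 : ℤ) ^ 12 * 7 ^ 3 * d ^ 6 =
      (natGenerator v : ℤ) ^ 12 * (343 * d ^ 6) by rw [hv]; push_cast; ring]
    push_cast
    have := Rat.valuation_pow_mul_intCast v hm 12
    push_cast at this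
    exact this
  have hvΔ' : v.valuation ℚ ((cm28Codomain d).map (Int.castRingHom ℚ)).Δ = WithZero.exp (-12 : ℤ) := by
    rw [map_Δ, eq_intCast, cm28Codomain_Δ, show -((2 : ℤ) ^ 12 * 7 ^ 3 * d ^ 6) =
      (natGenerator v : ℤ) ^ 12 * (-(343 * d ^ 6)) by rw [hv]; push_cast; ring]
    push_cast
    have := Rat.valuation_pow_mul_intCast v hm' 12
    push_cast at this
    exact this
  have hng := not_hasGoodReductionAt_two_of_c₆_eq_64_mul v _ hv hvΔ (N := 75411 * d ^ 3)
    (by rw [map_c₆, eq_intCast, cm28Model_c₆]; push_cast; ring) hN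
  have hng' := not_hasGoodReductionAt_two_of_c₆_eq_64_mul v _ hv hvΔ' (N := 1323 * d ^ 3)
    (by rw [map_c₆, eq_intCast, cm28Codomain_c₆]; push_cast; ring) hN'
  obtain ⟨h₁, h₂, h₃, h₄, h₆⟩ := valuation_map_a_le_one v (cm28Model d)
  obtain ⟨h₁', h₂', h₃', h₄', h₆'⟩ := valuation_map_a_le_one v (cm28Codomain d)
  refine ⟨hasAdditiveReductionAt_of_not_hasGoodReductionAt_of_cube_le v _ h₁ h₂ h₃ h₄ h₆ hng ?_,
    hasAdditiveReductionAt_of_not_hasGoodReductionAt_of_cube_le v _ h₁' h₂' h₃' h₄' h₆' hng' ?_⟩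
  · rw [map_Δ, map_c₄, eq_intCast, eq_intCast]
    refine Rat.valuation_cube_le_of_dvd v (e := 4) (n := 12) (m := 343 * d ^ 6) ?_ ?_ hm (by norm_num)
    · rw [cm28Model_c₄, hv]; exact ⟨1785 * d ^ 2, by push_cast; ring⟩
    · rw [cm28Model_Δ, hv]; push_cast; ring
  · rw [map_Δ, map_c₄, eq_intCast, eq_intCast]
    refine Rat.valuation_cube_le_of_dvd v (e := 4) (n := 12) (m := -(343 * d ^ 6)) ?_ ?_ hm'
      (by norm_num)
    · rw [cm28Codomain_c₄, hv]; exact ⟨105 * d ^ 2, by push_cast; ring⟩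
    · rw [cm28Codomain_Δ, hv]; push_cast; ring

end TwoThreeModFour

/-! ## `p = 2`, `d ≡ 1 (mod 4)`: good reduction at `2`, explicit models -/

section TwoOneModFour

variable (v : HeightOneSpectrum (𝓞 ℚ)) {d : ℤ}

/-- The `2`-integral model of `E_d` for `d = 8k + 1`:
`⟨2, 14d - 1, 1, 0⟩ • E_d = [1, -1, 0, -2380k² - 595k - 37, -44688k³ - 16163k² - 1946k - 78]`.
[folklore] -/
def cm28GoodModel₁ (k : ℤ) : WeierstrassCurve ℤ :=
  ⟨1, -1, 0, -2380 * k ^ 2 - 595 * k - 37, -44688 * k ^ 3 - 16163 * k ^ 2 - 1946 * k - 78⟩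

/-- The `2`-integral model of `E_d` for `d = 8k + 5`:
`⟨2, 14d - 1, 1, 4⟩ • E_d = [1, -1, 1, -2380k² - 2975k - 930, -44688k³ - 83195k² - 51625k - 10678]`.
[folklore] -/
def cm28GoodModel₅ (k : ℤ) : WeierstrassCurve ℤ :=
  ⟨1, -1, 1, -2380 * k ^ 2 - 2975 * k - 930, -44688 * k ^ 3 - 83195 * k ^ 2 - 51625 * k - 10678⟩

/-- The `2`-integral model of `E'_d` for `d = 8k + 1`:
`⟨2, -7d - 1, 1, 0⟩ • E'_d = [1, -1, 0, -140k² - 35k - 2, -784k³ - 259k² - 28k - 1]`. [folklore] -/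
def cm28GoodCodomain₁ (k : ℤ) : WeierstrassCurve ℤ :=
  ⟨1, -1, 0, -140 * k ^ 2 - 35 * k - 2, -784 * k ^ 3 - 259 * k ^ 2 - 28 * k - 1⟩

/-- The `2`-integral model of `E'_d` for `d = 8k + 5`:
`⟨2, -7d - 1, 1, 4⟩ • E'_d = [1, -1, 1, -140k² - 175k - 55, -784k³ - 1435k² - 875k - 178]`.
[folklore] -/
def cm28GoodCodomain₅ (k : ℤ) : WeierstrassCurve ℤ :=
  ⟨1, -1, 1, -140 * k ^ 2 - 175 * k - 55, -784 * k ^ 3 - 1435 * k ^ 2 - 875 * k - 178⟩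

variable (k : ℤ)

/-- `⟨2, 14d - 1, 1, 0⟩ • E_d = cm28GoodModel₁ k` for `d = 8k + 1`. [folklore] -/
theorem smul_cm28Model_eq₁ :
    (⟨Units.mk0 2 two_ne_zero, 14 * (8 * k + 1 : ℚ) - 1, 1, 0⟩ : VariableChange ℚ) •
        (cm28Model (8 * k + 1)).map (Int.castRingHom ℚ) =
      (cm28GoodModel₁ k).map (Int.castRingHom ℚ) := by
  rw [map_cm28Model]
  ext <;> simp only [variableChange_a₁, variableChange_a₂, variableChange_a₃, variableChange_a₄,
    variableChange_a₆, Units.val_inv_eq_inv_val, Units.val_mk0, cm28GoodModel₁, map_a₁, map_a₂,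
    map_a₃, map_a₄, map_a₆, eq_intCast] <;> push_cast <;> field_simp <;> ring

/-- `⟨2, 14d - 1, 1, 4⟩ • E_d = cm28GoodModel₅ k` for `d = 8k + 5`. [folklore] -/
theorem smul_cm28Model_eq₅ :
    (⟨Units.mk0 2 two_ne_zero, 14 * (8 * k + 5 : ℚ) - 1, 1, 4⟩ : VariableChange ℚ) •
        (cm28Model (8 * k + 5)).map (Int.castRingHom ℚ) =
      (cm28GoodModel₅ k).map (Int.castRingHom ℚ) := by
  rw [map_cm28Model]
  ext <;> simp only [variableChange_a₁, variableChange_a₂, variableChange_a₃, variableChange_a₄,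
    variableChange_a₆, Units.val_inv_eq_inv_val, Units.val_mk0, cm28GoodModel₅, map_a₁, map_a₂,
    map_a₃, map_a₄, map_a₆, eq_intCast] <;> push_cast <;> field_simp <;> ring

/-- `⟨2, -7d - 1, 1, 0⟩ • E'_d = cm28GoodCodomain₁ k` for `d = 8k + 1`. [folklore] -/
theorem smul_cm28Codomain_eq₁ :
    (⟨Units.mk0 2 two_ne_zero, -7 * (8 * k + 1 : ℚ) - 1, 1, 0⟩ : VariableChange ℚ) •
        (cm28Codomain (8 * k + 1)).map (Int.castRingHom ℚ) =
      (cm28GoodCodomain₁ k).map (Int.castRingHom ℚ) := by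
  rw [map_cm28Codomain]
  ext <;> simp only [variableChange_a₁, variableChange_a₂, variableChange_a₃, variableChange_a₄,
    variableChange_a₆, Units.val_inv_eq_inv_val, Units.val_mk0, cm28GoodCodomain₁, map_a₁, map_a₂,
    map_a₃, map_a₄, map_a₆, eq_intCast] <;> push_cast <;> field_simp <;> ring

/-- `⟨2, -7d - 1, 1, 4⟩ • E'_d = cm28GoodCodomain₅ k` for `d = 8k + 5`. [folklore] -/
theorem smul_cm28Codomain_eq₅ :
    (⟨Units.mk0 2 two_ne_zero, -7 * (8 * k + 5 : ℚ) - 1, 1, 4⟩ : VariableChange ℚ) •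
        (cm28Codomain (8 * k + 5)).map (Int.castRingHom ℚ) =
      (cm28GoodCodomain₅ k).map (Int.castRingHom ℚ) := by
  rw [map_cm28Codomain]
  ext <;> simp only [variableChange_a₁, variableChange_a₂, variableChange_a₃, variableChange_a₄,
    variableChange_a₆, Units.val_inv_eq_inv_val, Units.val_mk0, cm28GoodCodomain₅, map_a₁, map_a₂,
    map_a₃, map_a₄, map_a₆, eq_intCast] <;> push_cast <;> field_simp <;> ring

/-- The four explicit models have odd discriminants `±7³ d⁶`. [folklore] -/
theorem cm28Good_Δ :
    (cm28GoodModel₁ k).Δ = 343 * (8 * k + 1) ^ 6 ∧ (cm28GoodModel₅ k).Δ = 343 * (8 * k + 5) ^ 6 ∧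
      (cm28GoodCodomain₁ k).Δ = -(343 * (8 * k + 1) ^ 6) ∧
        (cm28GoodCodomain₅ k).Δ = -(343 * (8 * k + 5) ^ 6) := by
  refine ⟨?_, ?_, ?_, ?_⟩ <;>
    simp only [cm28GoodModel₁, cm28GoodModel₅, cm28GoodCodomain₁, cm28GoodCodomain₅, Δ, b₂, b₄, b₆,
      b₈] <;> ring

/-- An odd number to the sixth times `343` is odd. [folklore] -/
theorem not_two_dvd_343_mul_pow {m : ℤ} (hm : ¬ (2 : ℤ) ∣ m) : ¬ (2 : ℤ) ∣ 343 * m ^ 6 := by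
  intro h
  rcases Int.prime_two.dvd_or_dvd h with h | h
  · norm_num at h
  · exact hm (Int.prime_two.dvd_of_dvd_pow h)

/-- `#M(𝔽₂) = 2` for the model of `E_d`, `d ≡ 1 (mod 8)` (reduction `y² + xy = x³ + x² + αx + (α+1)`).
[folklore] -/
theorem natCard_cm28GoodModel₁_zmod_two :
    Nat.card ((cm28GoodModel₁ k).map (Int.castRingHom (ZMod 2))).toAffine.Point = 2 := by
  have h : (cm28GoodModel₁ k).map (Int.castRingHom (ZMod 2)) =
      ⟨1, -1, 0, -2380 * (k : ZMod 2) ^ 2 - 595 * (k : ZMod 2) - 37,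
        -44688 * (k : ZMod 2) ^ 3 - 16163 * (k : ZMod 2) ^ 2 - 1946 * (k : ZMod 2) - 78⟩ := by
    simp [cm28GoodModel₁, WeierstrassCurve.map]
  obtain hx | hx := (show ∀ x : ZMod 2, x = 0 ∨ x = 1 by decide) (k : ZMod 2) <;>
    (rw [hx] at h; rw [h, natCard_point_eq_one_add_card _ (by decide)]; decide)

/-- `#M(𝔽₂) = 2` for the model of `E'_d`, `d ≡ 1 (mod 8)`. [folklore] -/
theorem natCard_cm28GoodCodomain₁_zmod_two :
    Nat.card ((cm28GoodCodomain₁ k).map (Int.castRingHom (ZMod 2))).toAffine.Point = 2 := by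
  have h : (cm28GoodCodomain₁ k).map (Int.castRingHom (ZMod 2)) =
      ⟨1, -1, 0, -140 * (k : ZMod 2) ^ 2 - 35 * (k : ZMod 2) - 2,
        -784 * (k : ZMod 2) ^ 3 - 259 * (k : ZMod 2) ^ 2 - 28 * (k : ZMod 2) - 1⟩ := by
    simp [cm28GoodCodomain₁, WeierstrassCurve.map]
  obtain hx | hx := (show ∀ x : ZMod 2, x = 0 ∨ x = 1 by decide) (k : ZMod 2) <;>
    (rw [hx] at h; rw [h, natCard_point_eq_one_add_card _ (by decide)]; decide)

/-- `#M(𝔽₂) = 4` for the model of `E_d`, `d ≡ 5 (mod 8)` (reduction `y² + xy + y = x³ + x² + αx`).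
[folklore] -/
theorem natCard_cm28GoodModel₅_zmod_two :
    Nat.card ((cm28GoodModel₅ k).map (Int.castRingHom (ZMod 2))).toAffine.Point = 4 := by
  have h : (cm28GoodModel₅ k).map (Int.castRingHom (ZMod 2)) =
      ⟨1, -1, 1, -2380 * (k : ZMod 2) ^ 2 - 2975 * (k : ZMod 2) - 930,
        -44688 * (k : ZMod 2) ^ 3 - 83195 * (k : ZMod 2) ^ 2 - 51625 * (k : ZMod 2) - 10678⟩ := by
    simp [cm28GoodModel₅, WeierstrassCurve.map]
  obtain hx | hx := (show ∀ x : ZMod 2, x = 0 ∨ x = 1 by decide) (k : ZMod 2) <;>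
    (rw [hx] at h; rw [h, natCard_point_eq_one_add_card _ (by decide)]; decide)

/-- `#M(𝔽₂) = 4` for the model of `E'_d`, `d ≡ 5 (mod 8)`. [folklore] -/
theorem natCard_cm28GoodCodomain₅_zmod_two :
    Nat.card ((cm28GoodCodomain₅ k).map (Int.castRingHom (ZMod 2))).toAffine.Point = 4 := by
  have h : (cm28GoodCodomain₅ k).map (Int.castRingHom (ZMod 2)) =
      ⟨1, -1, 1, -140 * (k : ZMod 2) ^ 2 - 175 * (k : ZMod 2) - 55,
        -784 * (k : ZMod 2) ^ 3 - 1435 * (k : ZMod 2) ^ 2 - 875 * (k : ZMod 2) - 178⟩ := by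
    simp [cm28GoodCodomain₅, WeierstrassCurve.map]
  obtain hx | hx := (show ∀ x : ZMod 2, x = 0 ∨ x = 1 by decide) (k : ZMod 2) <;>
    (rw [hx] at h; rw [h, natCard_point_eq_one_add_card _ (by decide)]; decide)

variable {k}

/-- `E_d` is elliptic over `ℚ` for `d ≠ 0`. [folklore] -/
theorem isElliptic_cm28Model_map (hd : d ≠ 0) : ((cm28Model d).map (Int.castRingHom ℚ)).IsElliptic := by
  refine ⟨isUnit_iff_ne_zero.mpr ?_⟩
  rw [map_Δ, cm28Model_Δ]
  simp only [map_mul, map_pow, eq_intCast, Int.cast_ofNat]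
  exact mul_ne_zero (by norm_num) (pow_ne_zero _ (Int.cast_ne_zero.mpr hd))

/-- `E'_d` is elliptic over `ℚ` for `d ≠ 0`. [folklore] -/
theorem isElliptic_cm28Codomain_map (hd : d ≠ 0) :
    ((cm28Codomain d).map (Int.castRingHom ℚ)).IsElliptic := by
  refine ⟨isUnit_iff_ne_zero.mpr ?_⟩
  rw [map_Δ, cm28Codomain_Δ]
  simp only [map_neg, map_mul, map_pow, eq_intCast, Int.cast_ofNat, neg_ne_zero]
  exact mul_ne_zero (by norm_num) (pow_ne_zero _ (Int.cast_ne_zero.mpr hd))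

/-- **`d ≡ 1 (mod 8)`: equal local polynomials `1 - T + 2T²` at `2`** (good reduction, `a₂ = 1`
on both sides). [cite: Knapp1993, proof of Thm. 11.67] -/
theorem localPolynomial_cm28_two_eq_of_one_mod_eight (hv : natGenerator v = 2) (hd : d = 8 * k + 1) :
    (((cm28Model d).map (Int.castRingHom ℚ)).baseChange (v.adicCompletion ℚ)).localPolynomial
        (v.adicCompletionIntegers ℚ) =
      (((cm28Codomain d).map (Int.castRingHom ℚ)).baseChange (v.adicCompletion ℚ)).localPolynomial
        (v.adicCompletionIntegers ℚ) := by
  have hd0 : d ≠ 0 := by omega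
  haveI := isElliptic_cm28Model_map hd0
  haveI := isElliptic_cm28Codomain_map hd0
  have hodd : ¬ (2 : ℤ) ∣ 8 * k + 1 := by omega
  subst hd
  obtain ⟨hΔ₁, -, hΔ₁', -⟩ := cm28Good_Δ k
  have e1 := localPolynomial_two_of_model v hv ((cm28Model (8 * k + 1)).map (Int.castRingHom ℚ))
    (cm28GoodModel₁ k) ⟨Units.mk0 2 two_ne_zero, 14 * (8 * k + 1 : ℚ) - 1, 1, 0⟩
    (smul_cm28Model_eq₁ k)
    (by rw [hΔ₁]; exact not_two_dvd_343_mul_pow hodd)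
  have e2 := localPolynomial_two_of_model v hv ((cm28Codomain (8 * k + 1)).map (Int.castRingHom ℚ))
    (cm28GoodCodomain₁ k) ⟨Units.mk0 2 two_ne_zero, -7 * (8 * k + 1 : ℚ) - 1, 1, 0⟩
    (smul_cm28Codomain_eq₁ k)
    (by rw [hΔ₁', dvd_neg]; exact not_two_dvd_343_mul_pow hodd)
  rw [e1, e2, natCard_cm28GoodModel₁_zmod_two, natCard_cm28GoodCodomain₁_zmod_two]

/-- **`d ≡ 5 (mod 8)`: equal local polynomials `1 + T + 2T²` at `2`** (good reduction, `a₂ = -1`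
on both sides). [cite: Knapp1993, proof of Thm. 11.67] -/
theorem localPolynomial_cm28_two_eq_of_five_mod_eight (hv : natGenerator v = 2) (hd : d = 8 * k + 5) :
    (((cm28Model d).map (Int.castRingHom ℚ)).baseChange (v.adicCompletion ℚ)).localPolynomial
        (v.adicCompletionIntegers ℚ) =
      (((cm28Codomain d).map (Int.castRingHom ℚ)).baseChange (v.adicCompletion ℚ)).localPolynomial
        (v.adicCompletionIntegers ℚ) := by
  have hd0 : d ≠ 0 := by omega
  haveI := isElliptic_cm28Model_map hd0
  haveI := isElliptic_cm28Codomain_map hd0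
  have hodd : ¬ (2 : ℤ) ∣ 8 * k + 5 := by omega
  subst hd
  obtain ⟨-, hΔ₅, -, hΔ₅'⟩ := cm28Good_Δ k
  have e1 := localPolynomial_two_of_model v hv ((cm28Model (8 * k + 5)).map (Int.castRingHom ℚ))
    (cm28GoodModel₅ k) ⟨Units.mk0 2 two_ne_zero, 14 * (8 * k + 5 : ℚ) - 1, 1, 4⟩
    (smul_cm28Model_eq₅ k)
    (by rw [hΔ₅]; exact not_two_dvd_343_mul_pow hodd)
  have e2 := localPolynomial_two_of_model v hv ((cm28Codomain (8 * k + 5)).map (Int.castRingHom ℚ))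
    (cm28GoodCodomain₅ k) ⟨Units.mk0 2 two_ne_zero, -7 * (8 * k + 5 : ℚ) - 1, 1, 4⟩
    (smul_cm28Codomain_eq₅ k)
    (by rw [hΔ₅', dvd_neg]; exact not_two_dvd_343_mul_pow hodd)
  rw [e1, e2, natCard_cm28GoodModel₅_zmod_two, natCard_cm28GoodCodomain₅_zmod_two]

end TwoOneModFour

/-! ## Good odd places `p ∤ 14d` -/

section Good

variable {p : ℕ} [Fact p.Prime] {d : ℤ}

/-- **`#E_d(𝔽_p) = #E'_d(𝔽_p)` for `p ∤ 14d`** (the reductions are `2`-isogenous over `𝔽_p`;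
`E'_d = ⟨2, 0, 0, 0⟩ • [0, 84d, 0, 1792d², 0]`). [cite: Knapp1993, proof of Thm. 11.67, (11.89)] -/
theorem natCard_point_cm28_zmod_eq (hpd : ¬ (p : ℤ) ∣ 14 * d) :
    Nat.card ((cm28Model d).map (Int.castRingHom (ZMod p))).toAffine.Point =
      Nat.card ((cm28Codomain d).map (Int.castRingHom (ZMod p))).toAffine.Point := by
  have h2 : (2 : ZMod p) ≠ 0 := fun h ↦ hpd <| by
    have : (p : ℤ) ∣ 2 := by
      have := (ZMod.intCast_zmod_eq_zero_iff_dvd 2 p).mp (by exact_mod_cast h)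
      exact_mod_cast this
    exact this.trans ⟨7 * d, by ring⟩
  have h7 : (7 : ZMod p) ≠ 0 := fun h ↦ hpd <| by
    have : (p : ℤ) ∣ 7 := by
      have := (ZMod.intCast_zmod_eq_zero_iff_dvd 7 p).mp (by exact_mod_cast h)
      exact_mod_cast this
    exact this.trans ⟨2 * d, by ring⟩
  have hd : ((d : ℤ) : ZMod p) ≠ 0 := fun h ↦
    hpd (((ZMod.intCast_zmod_eq_zero_iff_dvd d p).mp h).mul_left 14)
  have hE : (cm28Model d).map (Int.castRingHom (ZMod p)) =
      ⟨0, -42 * (d : ZMod p), 0, -7 * (d : ZMod p) ^ 2, 0⟩ := map_cm28Model d _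
  haveI : (⟨0, -42 * (d : ZMod p), 0, -7 * (d : ZMod p) ^ 2, 0⟩ : WeierstrassCurve (ZMod p)).IsElliptic := by
    refine ⟨isUnit_iff_ne_zero.mpr ?_⟩
    rw [← hE, map_Δ, cm28Model_Δ]
    simp only [map_mul, map_pow, eq_intCast, Int.cast_ofNat]
    exact mul_ne_zero (mul_ne_zero (pow_ne_zero _ h2) (pow_ne_zero _ h7)) (pow_ne_zero _ hd)
  have hF : (cm28Codomain d).map (Int.castRingHom (ZMod p)) =
      (⟨Units.mk0 2 h2, 0, 0, 0⟩ : VariableChange (ZMod p)) •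
        ⟨0, -2 * (-42 * (d : ZMod p)), 0, (-42 * (d : ZMod p)) ^ 2 - 4 * (-7 * (d : ZMod p) ^ 2), 0⟩ := by
    rw [map_cm28Codomain]
    ext
    · simp [variableChange_a₁]
    · simp only [variableChange_a₂, Units.val_inv_eq_inv_val, Units.val_mk0]
      field_simp
      ring
    · simp [variableChange_a₃]
    · simp only [variableChange_a₄, Units.val_inv_eq_inv_val, Units.val_mk0]
      field_simp
      ring
    · simp [variableChange_a₆]
  rw [hE, hF, natCard_point_smul]
  exact natCard_point_twoTorsionNF_eq _ _

end Good

/-! ## Assembly -/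

section Assembly

variable {d : ℤ}

/-- **The local polynomials of `E_d` and `E'_d` agree at every finite place of `ℚ`**
(`d` squarefree). [cite: Knapp1993, proof of Thm. 11.67 (PDF pp. 281–282)] -/
theorem localPolynomial_cm28_eq (hsq : Squarefree d) (v : HeightOneSpectrum (𝓞 ℚ)) :
    (((cm28Model d).map (Int.castRingHom ℚ)).baseChange (v.adicCompletion ℚ)).localPolynomial
        (v.adicCompletionIntegers ℚ) =
      (((cm28Codomain d).map (Int.castRingHom ℚ)).baseChange (v.adicCompletion ℚ)).localPolynomial
        (v.adicCompletionIntegers ℚ) := by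
  have hpZ := Rat.prime_natGenerator_int v
  by_cases hp2 : natGenerator v = 2
  · -- the place over `2`
    have hmod : (2 : ℤ) ∣ d ∨ (∃ k, d = 4 * k + 3) ∨ (∃ k, d = 8 * k + 1) ∨ (∃ k, d = 8 * k + 5) := by
      rcases Int.emod_two_eq_zero_or_one d with h | h
      · exact Or.inl (Int.dvd_of_emod_eq_zero h)
      · right
        have h8 := Int.emod_emod_of_dvd d (show (2 : ℤ) ∣ 8 by norm_num)
        have : d % 8 = 1 ∨ d % 8 = 3 ∨ d % 8 = 5 ∨ d % 8 = 7 := by omega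
        rcases this with h1 | h3 | h5 | h7
        · exact Or.inr (Or.inl ⟨d / 8, by omega⟩)
        · exact Or.inl ⟨2 * (d / 8), by omega⟩
        · exact Or.inr (Or.inr ⟨d / 8, by omega⟩)
        · exact Or.inl ⟨2 * (d / 8) + 1, by omega⟩
    rcases hmod with h | ⟨k, hk⟩ | ⟨k, hk⟩ | ⟨k, hk⟩
    · exact localPolynomial_eq_of_hasAdditiveReductionAt v
        (hasAdditiveReductionAt_cm28Model v hsq (Or.inr ⟨hp2, h⟩))
        (hasAdditiveReductionAt_cm28Codomain v hsq (Or.inr ⟨hp2, h⟩))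
    · obtain ⟨h1, h2⟩ := hasAdditiveReductionAt_cm28_two_of_three_mod_four v hp2 hk
      exact localPolynomial_eq_of_hasAdditiveReductionAt v h1 h2
    · exact localPolynomial_cm28_two_eq_of_one_mod_eight v hp2 hk
    · exact localPolynomial_cm28_two_eq_of_five_mod_eight v hp2 hk
  by_cases hv : (natGenerator v : ℤ) ∣ 7 * d
  · exact localPolynomial_eq_of_hasAdditiveReductionAt v
      (hasAdditiveReductionAt_cm28Model v hsq (Or.inl hv))
      (hasAdditiveReductionAt_cm28Codomain v hsq (Or.inl hv))
  · -- good odd prime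
    haveI := Fact.mk (prime_natGenerator v)
    have h14 : ¬ (natGenerator v : ℤ) ∣ 14 * d := fun h ↦ by
      rw [show (14 : ℤ) * d = 2 * (7 * d) by ring] at h
      rcases hpZ.dvd_or_dvd h with h | h
      · exact hp2 (Rat.natGenerator_eq_of_dvd v Nat.prime_two h)
      · exact hv h
    have hdvd : ∀ m : ℤ, m = 2 ^ 12 * 7 ^ 3 * d ^ 6 → ¬ (natGenerator v : ℤ) ∣ m := by
      rintro m rfl h
      rcases hpZ.dvd_or_dvd h with h | h
      · rcases hpZ.dvd_or_dvd h with h | h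
        · exact hp2 (Rat.natGenerator_eq_of_dvd v Nat.prime_two (hpZ.dvd_of_dvd_pow h))
        · exact hv ((hpZ.dvd_of_dvd_pow h).trans (dvd_mul_right 7 d))
      · exact hv ((hpZ.dvd_of_dvd_pow h).mul_left 7)
    refine localPolynomial_map_eq_of_natCard_eq v _ _ ?_ ?_ (natCard_point_cm28_zmod_eq h14)
    · rw [cm28Model_Δ]; exact hdvd _ rfl
    · rw [cm28Codomain_Δ, dvd_neg]; exact hdvd _ rfl

/-- **`L(E_d, s) = L(E'_d, s)`** for the `2`-isogenous CM curves `E_d = [0, -42d, 0, -7d², 0]`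
(`j = 16581375`) and `E'_d = [0, 21d, 0, 112d², 0]` (`j = -3375`), every squarefree `d`: Knapp's
Theorem 11.67 for this isogeny class, for Mathlib's `WeierstrassCurve.LFunction`.
[cite: Knapp1993, Thm. 11.67 (PDF p. 281)] -/
theorem LFunction_cm28_eq (hsq : Squarefree d) :
    ((cm28Model d).map (Int.castRingHom ℚ)).LFunction =
      ((cm28Codomain d).map (Int.castRingHom ℚ)).LFunction :=
  LFunction_eq_of_forall_localPolynomial_eq (localPolynomial_cm28_eq hsq)

/-- `E_d ~ E'_d` over `ℚ` (Silverman III.4.5). [cite: SilvermanAEC2009, III.4 Example 4.5] -/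
theorem isIsogenous_cm28Model (hd : d ≠ 0) :
    IsIsogenous ((cm28Model d).map (Int.castRingHom ℚ)) ((cm28Codomain d).map (Int.castRingHom ℚ)) := by
  have hE : (cm28Model d).map (Int.castRingHom ℚ) = ⟨0, -42 * (d : ℚ), 0, -7 * (d : ℚ) ^ 2, 0⟩ :=
    map_cm28Model d _
  haveI : (⟨0, -42 * (d : ℚ), 0, -7 * (d : ℚ) ^ 2, 0⟩ : WeierstrassCurve ℚ).IsElliptic :=
    hE ▸ isElliptic_cm28Model_map hd
  have hF : (cm28Codomain d).map (Int.castRingHom ℚ) =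
      (⟨Units.mk0 2 two_ne_zero, 0, 0, 0⟩ : VariableChange ℚ) •
        (⟨0, -42 * (d : ℚ), 0, -7 * (d : ℚ) ^ 2, 0⟩ : WeierstrassCurve ℚ).twoIsogenyCodomain := by
    rw [map_cm28Codomain]
    ext
    · simp [variableChange_a₁, twoIsogenyCodomain]
    · simp only [variableChange_a₂, twoIsogenyCodomain, Units.val_inv_eq_inv_val, Units.val_mk0]
      field_simp
      ring
    · simp [variableChange_a₃, twoIsogenyCodomain]
    · simp only [variableChange_a₄, twoIsogenyCodomain, Units.val_inv_eq_inv_val, Units.val_mk0]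
      field_simp
      ring
    · simp [variableChange_a₆, twoIsogenyCodomain]
  rw [hE, hF]
  exact IsIsogenous.trans' (isIsogenous_twoIsogenyCodomain _) (isIsogenous_smul _ _)

/-- **Knapp 11.67 for the class `j = 16581375 ~ -3375`, in the form consumed by the CM
reductions**. [cite: Knapp1993, Thm. 11.67] -/
theorem isIsogenous_and_LFunction_eq_cm28 (hd : d ≠ 0) (hsq : Squarefree d) :
    IsIsogenous ((cm28Model d).map (Int.castRingHom ℚ)) ((cm28Codomain d).map (Int.castRingHom ℚ)) ∧
      ((cm28Model d).map (Int.castRingHom ℚ)).LFunction =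
        ((cm28Codomain d).map (Int.castRingHom ℚ)).LFunction :=
  ⟨isIsogenous_cm28Model hd, LFunction_cm28_eq hsq⟩

end Assembly

end WeierstrassCurve
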